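import Summits.QuantumFields.YangMills.Theorems.UnitScaleTiltProp8ChartDoubleBarBall
import Summits.QuantumFields.YangMills.Theorems.UnitScaleTiltProp8ChartDoubleBarDeriv
import Summits.QuantumFields.YangMills.Theorems.UnitScaleTiltProp8ChartHInvComb
import Literature.MathematicalPhysics.QuantumFieldTheory.Balaban1983to89.B15AveragingHolomorphic
import HarnessLib

/-!
# Route `UnitScaleTilt`, crux K1 «MinimiserStabilityRegPr» (stmt-QuantumFields-19200), stub V2′ `stub_halvingStep` — pillar P3, the double-bar chart of record:
# **THE REAL STRUCTURE OF `Q♭`: `chartLogFlat η D (A⋆) = (chartLogFlat η D A)⋆`** — the involution `θ : M ↦ (M⋆)⁻¹` of [Balaban1985Variational] p.307 («`Gᶜ`-valued fields»)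
# passes through `e^{iη·}`, transporters, `exp[mean log]` (✓`B15AveragingHolomorphic.eml_star_inv`), the block frames, the (89) double-bar step and its iterate, on the read territory
# of an index (GUARDED: `‖U̿ − 1‖ ≤ 1∕3` from ✓`norm_dbarIterU_sub_one_le_two_mul₀`); (★★OWNER ACK 28 (4): the `hΨsa` adapter of the (H-E2E) census, row S11, part 1)

Cell `ym3-torus` (HUMAN RULING D-0037: YM₃ on the torus is ladder rung R3, not the Clay problem), width seat `ym-ust-19200-w8` g0∕s2.
`--supports stmt-QuantumFields-19200 --as helper`; definition-free, 0 sorry.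

WHY.  The P5 entry ✓`HalvingDressedCriticalitySU2.tracePairing_of_isMinOn_dressed_wilson_su2` asks the DRESSED competitors `X − Hs(D X)` to be bondwise self-adjoint (`hΨsa`).  With
`D = Dsel` the unique small solution of (49) `D X = C♭(X − Hs(D X))` (✓p616882 FILE E), self-adjointness of `D X` follows from UNIQUENESS once `C♭ = Q♭ − Q_lin` commutes with the
entrywise adjoint: then `(D X)⋆` solves (49) too.  ✓p616809 gives only «self-adjoint in ⇒ self-adjoint out»; this file gives the EQUIVARIANCE `Q♭(A⋆) = Q♭(A)⋆` for every `A` in the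
ball (and `Q_lin(A⋆) = Q_lin(A)⋆` by CERT-2), which is what the uniqueness argument needs.

WHAT THIS FILE PROVES (no definition, no sorry):
* §1 `holT_rel_of_walk` — a relation closed under `1`, `*`, `⁻¹` between the bond variables READ by a walk passes to the transporters (any two groups).
* §2 (on `M₂(ℂ)ˣ`-fields, L²-operator norm; the relation `θ`: `↑a′ = (↑a⁻¹)⋆`) `theta_one∕_mul∕_inv`, `theta_emlUnit` (✓`eml_star_inv` on `1∕3`-small tuples), **`theta_dbarAvgU`** (one
  (89) step, two-block near-flatness `12ℓs ≤ 1`), **`theta_dbarIterU_of_reads`** (the tower on the read territory, budget `30400·ℓ²·Lⁱ·s₀ ≤ 1`), base `coe_expCfg_star`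
  (`e^{iη A⋆} = θ(e^{iηA})` bondwise).
* §3 ★★ **`chartLogFlat_star_of_reads`** (index form) and ★★ **`chartLogFlat_star_weightedBall₀`** (letters of ✓`norm_chartLogFlat_le_weightedBall₀`): `Q♭(A⋆)(j,c) = (Q♭(A)(j,c))⋆`;
  **`fderiv_chartLogFlat_zero_star`**: `Q_lin(A⋆) = Q_lin(A)⋆` (CERT-2 ✓`fderiv_chartLogFlat_zero_apply`, real coefficient `η·Lʲ`).
* §4 **`isSelfAdjoint_dressed_of_unique`** (abstract (49) + uniqueness ⇒ `Dv` and `A′ − Hs Dv` self-adjoint) and ★★ **`isSelfAdjoint_dressed_chartOfRecord`** (the same for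
  `C♭ = Q♭ − Q_lin` in FILE E's (49)∕(55)∕uniqueness shapes, dressed point in the ball of record) = census S11 `hΨsa`.
HONEST SCOPE.  Bookkeeping over landed letters.  NOT a claim about the stub, the crux, the rung or the mass gap.

References: T. Bałaban, CMP **102** (1985) 277–309 [Balaban1985Variational] ((20) p.281, (47)–(49) pp.285–286, p.307); CMP **109** (1987) 249–301 [Balaban1987RG1] ((0.4)–(0.5) p.253);
CMP **98** (1985) 17–51 [Balaban1985Averaging] ((23) p.21, (89) p.31, (110) p.34).
-/

set_option autoImplicit false

noncomputable section

open scoped BigOperators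
open NormedSpace

namespace Summit.QuantumFields.YangMills.Theorems.Prop8ChartDoubleBar

open Literature.MathematicalPhysics.QuantumFieldTheory.Balaban1983to89
open T4Continuum BlockAveraging AveragingRT ExpMeanLog MatrixLog
open B10Eq27TorusAxialLog (holT holT_nil holT_cons_true holT_cons_false)
open B5Eq118OneStroke (iterBlockOf iterBlockOf_succ iterBlockOf_zero)
open B6SectADomainsV1 (Domains)
open B6SectAOperatorsV1 (BondIdx)
open T3ContinuumYM3Torus (T3Family)
open LatticeFieldCalculus (bondAvgIter)
open Summit.QuantumFields.YangMills.Theorems.FlatCubeOpsText (IsLevWeight)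
open Summit.QuantumFields.YangMills.Theorems.Prop8Chart
open B15AveragingHolomorphic (eml_star_inv mlog_star_inv)

variable {P : Params}

/-! ## §1 Relations along transporters -/

section Rel

variable {G G' : Type*} [Group G] [Group G'] {j : ℕ}

/-- **A MULTIPLICATIVE RELATION READ ALONG A WALK PASSES TO THE TRANSPORTERS**: if `R 1 1`, `R` is closed under `*` and `⁻¹`, and `R (V b) (V′ b)` for every bond read by the
walk spelled by `w` from `x`, then `R (V(Γ_{x,w})) (V′(Γ_{x,w}))`. [cite: Balaban1985Averaging, (8)-(9) pp.18-19] -/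
theorem holT_rel_of_walk (R : G → G' → Prop) (h1 : R 1 1) (hmul : ∀ a b a' b', R a a' → R b b' → R (a * b) (a' * b')) (hinv : ∀ a a', R a a' → R a⁻¹ a'⁻¹)
    (V : GaugeField P j G) (V' : GaugeField P j G') :
    ∀ (x : Site P j) (w : List (Letter P.d)), (∀ st ∈ walk x w, R (V st.bond) (V' st.bond)) → R (holT V x w) (holT V' x w)
  | x, [], _ => by rw [holT_nil, holT_nil]; exact h1
  | x, (μ, true) :: w, h => by
    rw [holT_cons_true, holT_cons_true]
    have hcons : walk x ((μ, true) :: w) = ⟨⟨x, μ⟩, true⟩ :: walk (x.shift μ) w := rfl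
    refine hmul _ _ _ _ (h ⟨⟨x, μ⟩, true⟩ (by rw [hcons]; exact List.mem_cons_self)) ?_
    exact holT_rel_of_walk R h1 hmul hinv V V' (x.shift μ) w fun st hst => h st (by rw [hcons]; exact List.mem_cons_of_mem _ hst)
  | x, (μ, false) :: w, h => by
    rw [holT_cons_false, holT_cons_false]
    have hcons : walk x ((μ, false) :: w) = ⟨⟨x.unshift μ, μ⟩, false⟩ :: walk (x.unshift μ) w := rfl
    refine hmul _ _ _ _ (hinv _ _ (h ⟨⟨x.unshift μ, μ⟩, false⟩ (by rw [hcons]; exact List.mem_cons_self))) ?_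
    exact holT_rel_of_walk R h1 hmul hinv V V' (x.unshift μ) w fun st hst => h st (by rw [hcons]; exact List.mem_cons_of_mem _ hst)

end Rel

/-! ## §2 The involution `θ(a) = (a⁻¹)⋆` through the double-bar tower on `M₂(ℂ)ˣ`-fields -/

section Theta

open scoped Matrix.Norms.L2Operator

/-- `θ(1) = 1`. [folklore] -/
theorem theta_one : (((1 : (Matrix (Fin 2) (Fin 2) ℂ)ˣ)) : Matrix (Fin 2) (Fin 2) ℂ) =
    star ((((1 : (Matrix (Fin 2) (Fin 2) ℂ)ˣ))⁻¹ : (Matrix (Fin 2) (Fin 2) ℂ)ˣ) : Matrix (Fin 2) (Fin 2) ℂ) := by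
  rw [inv_one, Units.val_one, star_one]

/-- `θ(ab) = θ(a)θ(b)` (the two order reversals cancel). [folklore] -/
theorem theta_mul {a b a' b' : (Matrix (Fin 2) (Fin 2) ℂ)ˣ}
    (ha : (a' : Matrix (Fin 2) (Fin 2) ℂ) = star ((a⁻¹ : (Matrix (Fin 2) (Fin 2) ℂ)ˣ) : Matrix (Fin 2) (Fin 2) ℂ))
    (hb : (b' : Matrix (Fin 2) (Fin 2) ℂ) = star ((b⁻¹ : (Matrix (Fin 2) (Fin 2) ℂ)ˣ) : Matrix (Fin 2) (Fin 2) ℂ)) :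
    ((a' * b' : (Matrix (Fin 2) (Fin 2) ℂ)ˣ) : Matrix (Fin 2) (Fin 2) ℂ) = star (((a * b)⁻¹ : (Matrix (Fin 2) (Fin 2) ℂ)ˣ) : Matrix (Fin 2) (Fin 2) ℂ) := by
  rw [Units.val_mul, ha, hb, mul_inv_rev, Units.val_mul, star_mul]

/-- `θ(a⁻¹) = θ(a)⁻¹`. [folklore] -/
theorem theta_inv {a a' : (Matrix (Fin 2) (Fin 2) ℂ)ˣ}
    (ha : (a' : Matrix (Fin 2) (Fin 2) ℂ) = star ((a⁻¹ : (Matrix (Fin 2) (Fin 2) ℂ)ˣ) : Matrix (Fin 2) (Fin 2) ℂ)) :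
    ((a'⁻¹ : (Matrix (Fin 2) (Fin 2) ℂ)ˣ) : Matrix (Fin 2) (Fin 2) ℂ) = star (((a⁻¹)⁻¹ : (Matrix (Fin 2) (Fin 2) ℂ)ˣ) : Matrix (Fin 2) (Fin 2) ℂ) := by
  rw [inv_inv]
  refine Units.inv_eq_of_mul_eq_one_right ?_
  rw [ha, ← star_mul, ← Units.val_mul, mul_inv_cancel, Units.val_one, star_one]

/-- **`θ` THROUGH `exp[mean log]`** on a `1∕3`-small tuple (✓`eml_star_inv`), at the level of the units `(isUnit_eml ·).unit`. [cite: Balaban1987RG1, (0.4)-(0.5) p.253] -/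
theorem theta_emlUnit {W W' : Idx P → Matrix (Fin 2) (Fin 2) ℂ} (hW : ∀ i, ‖W i - 1‖ ≤ 1 / 3) (hθ : ∀ i, W' i = star ((W i)⁻¹)) :
    (((isUnit_eml W').unit : (Matrix (Fin 2) (Fin 2) ℂ)ˣ) : Matrix (Fin 2) (Fin 2) ℂ) =
      star ((((isUnit_eml W).unit)⁻¹ : (Matrix (Fin 2) (Fin 2) ℂ)ˣ) : Matrix (Fin 2) (Fin 2) ℂ) := by
  rw [IsUnit.unit_spec, Matrix.coe_units_inv, IsUnit.unit_spec]
  have hW' : W' = fun i => (star (W i))⁻¹ := funext fun i => by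
    rw [hθ i, Matrix.star_eq_conjTranspose, Matrix.star_eq_conjTranspose, Matrix.conjTranspose_nonsing_inv]
  rw [hW', eml_star_inv hW, Matrix.star_eq_conjTranspose, Matrix.star_eq_conjTranspose, Matrix.conjTranspose_nonsing_inv]

/-- **ONE DOUBLE-BAR STEP COMMUTES WITH `θ`** on the two blocks of `c`: if `S′ = θ ∘ S` on the two-block bonds, which are within `s` of `1`, `12ℓs ≤ 1`, then
`U̿′(c) = θ(U̿(c))`. [cite: Balaban1985Averaging, (89) p.31, (110) p.34; Balaban1987RG1, (0.4)-(0.5) p.253] -/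
theorem theta_dbarAvgU {j : ℕ} (hj : j + 1 ≤ P.m + P.K) {S S' : GaugeField P j (Matrix (Fin 2) (Fin 2) ℂ)ˣ} (c : PBond P (j + 1)) {s : ℝ} (hs0 : 0 ≤ s)
    (hℓs : 12 * (((P.d + 2) * P.L : ℕ) : ℝ) * s ≤ 1)
    (hS : ∀ b : PBond P j, (blockOf b.src = c.src ∨ blockOf b.src = c.tgt) → (blockOf b.tgt = c.src ∨ blockOf b.tgt = c.tgt) →
      ‖((S b : (Matrix (Fin 2) (Fin 2) ℂ)ˣ) : Matrix (Fin 2) (Fin 2) ℂ) - 1‖ ≤ s)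
    (hθ : ∀ b : PBond P j, (blockOf b.src = c.src ∨ blockOf b.src = c.tgt) → (blockOf b.tgt = c.src ∨ blockOf b.tgt = c.tgt) →
      ((S' b : (Matrix (Fin 2) (Fin 2) ℂ)ˣ) : Matrix (Fin 2) (Fin 2) ℂ) = star (((S b)⁻¹ : (Matrix (Fin 2) (Fin 2) ℂ)ˣ) : Matrix (Fin 2) (Fin 2) ℂ)) :
    ((dbarAvgU S' c : (Matrix (Fin 2) (Fin 2) ℂ)ˣ) : Matrix (Fin 2) (Fin 2) ℂ) = star (((dbarAvgU S c)⁻¹ : (Matrix (Fin 2) (Fin 2) ℂ)ˣ) : Matrix (Fin 2) (Fin 2) ℂ) := by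
  have hℓs4 : 4 * (((P.d + 2) * P.L : ℕ) : ℝ) * s ≤ 1 := by
    have : 0 ≤ (((P.d + 2) * P.L : ℕ) : ℝ) * s := by positivity
    linarith
  have hthird : 4 * (((P.d + 2) * P.L : ℕ) : ℝ) * s ≤ 1 / 3 := by
    have : 0 ≤ (((P.d + 2) * P.L : ℕ) : ℝ) * s := by positivity
    linarith
  -- `θ` along walks that read related bonds
  have hwalk : ∀ (x : Site P j) (w : List (Letter P.d)),
      (∀ st ∈ walk x w, ((S' st.bond : (Matrix (Fin 2) (Fin 2) ℂ)ˣ) : Matrix (Fin 2) (Fin 2) ℂ) =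
        star (((S st.bond)⁻¹ : (Matrix (Fin 2) (Fin 2) ℂ)ˣ) : Matrix (Fin 2) (Fin 2) ℂ)) →
      ((holT S' x w : (Matrix (Fin 2) (Fin 2) ℂ)ˣ) : Matrix (Fin 2) (Fin 2) ℂ) = star (((holT S x w)⁻¹ : (Matrix (Fin 2) (Fin 2) ℂ)ˣ) : Matrix (Fin 2) (Fin 2) ℂ) :=
    fun x w hw => holT_rel_of_walk
      (fun (a a' : (Matrix (Fin 2) (Fin 2) ℂ)ˣ) => (a' : Matrix (Fin 2) (Fin 2) ℂ) = star ((a⁻¹ : (Matrix (Fin 2) (Fin 2) ℂ)ˣ) : Matrix (Fin 2) (Fin 2) ℂ))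
      theta_one (fun _ _ _ _ ha hb => theta_mul ha hb) (fun _ _ ha => theta_inv ha) S S' x w hw
  -- the frames at the two ends
  have hframe : ∀ y : Site P (j + 1), (y = c.src ∨ y = c.tgt) →
      ((vframeU S' y : (Matrix (Fin 2) (Fin 2) ℂ)ˣ) : Matrix (Fin 2) (Fin 2) ℂ) = star (((vframeU S y)⁻¹ : (Matrix (Fin 2) (Fin 2) ℂ)ˣ) : Matrix (Fin 2) (Fin 2) ℂ) := by
    intro y hy
    have hSy : ∀ b : PBond P j, blockOf b.src = y → blockOf b.tgt = y → ‖((S b : (Matrix (Fin 2) (Fin 2) ℂ)ˣ) : Matrix (Fin 2) (Fin 2) ℂ) - 1‖ ≤ s := by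
      intro b hb1 hb2
      refine hS b ?_ ?_
      · rw [hb1]; exact hy
      · rw [hb2]; exact hy
    refine theta_emlUnit (fun i => ((norm_holT_stair_sub_one_le hj y hs0 hℓs4 hSy i).1).trans hthird) fun i => ?_
    rw [← Matrix.coe_units_inv]
    refine hwalk _ _ fun st hst => hθ st.bond ?_ ?_
    · rw [(blockOf_ends_of_mem_stairWalk hj y i.1 i.2.1 st hst).1]; exact hy
    · rw [(blockOf_ends_of_mem_stairWalk hj y i.1 i.2.1 st hst).2]; exact hy
  -- the single-bar average: `eml` of the loops times the straight transporter
  have havg : ((emlAvgU S' c : (Matrix (Fin 2) (Fin 2) ℂ)ˣ) : Matrix (Fin 2) (Fin 2) ℂ) =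
      star (((emlAvgU S c)⁻¹ : (Matrix (Fin 2) (Fin 2) ℂ)ˣ) : Matrix (Fin 2) (Fin 2) ℂ) := by
    unfold emlAvgU
    refine theta_mul (theta_emlUnit (fun i => ((norm_loopHolU_sub_one_le hj c hs0 hℓs4 hS i).1).trans hthird) fun i => ?_) ?_
    · rw [← Matrix.coe_units_inv]
      exact hwalk _ _ fun st hst => hθ st.bond (two_block_of_mem_loopWalk hj c i hst).1 (two_block_of_mem_loopWalk hj c i hst).2
    · exact hwalk _ _ fun st hst => hθ st.bond (two_block_of_mem_lineWalk hj c hst).1 (two_block_of_mem_lineWalk hj c hst).2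
  rw [dbarAvgU_apply, dbarAvgU_apply]
  exact theta_mul (theta_mul (theta_inv (hframe c.src (Or.inl rfl))) havg) (hframe c.tgt (Or.inr rfl))

/-- **THE DOUBLE-BAR TOWER COMMUTES WITH `θ` ON THE READ TERRITORY**: if `U′ = θ ∘ U` and `U` is within `s₀` of `1` on every fine bond whose level-`i` blocks lie in `S`,
`30400·ℓ²·Lⁱ·s₀ ≤ 1`, then `U̿′^{(i)}(e) = θ(U̿^{(i)}(e))` for every `e` with both ends in `S`. [cite: Balaban1985Averaging, Prop. 4 (134)-(135) p.38; Balaban1987RG1, (0.5) p.253] -/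
theorem theta_dbarIterU_of_reads :
    ∀ (i : ℕ), i ≤ P.m + P.K → ∀ (S : Set (Site P i)) (U U' : GaugeField P 0 (Matrix (Fin 2) (Fin 2) ℂ)ˣ) (s₀ : ℝ), 0 ≤ s₀ →
      8 * 3800 * (((P.d + 2) * P.L : ℕ) : ℝ) ^ 2 * (P.L : ℝ) ^ i * s₀ ≤ 1 →
      (∀ b : PBond P 0, iterBlockOf i b.src ∈ S → iterBlockOf i b.tgt ∈ S → ‖((U b : (Matrix (Fin 2) (Fin 2) ℂ)ˣ) : Matrix (Fin 2) (Fin 2) ℂ) - 1‖ ≤ s₀) →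
      (∀ b : PBond P 0, iterBlockOf i b.src ∈ S → iterBlockOf i b.tgt ∈ S →
        ((U' b : (Matrix (Fin 2) (Fin 2) ℂ)ˣ) : Matrix (Fin 2) (Fin 2) ℂ) = star (((U b)⁻¹ : (Matrix (Fin 2) (Fin 2) ℂ)ˣ) : Matrix (Fin 2) (Fin 2) ℂ)) →
      ∀ e : PBond P i, e.src ∈ S → e.tgt ∈ S →
        ((dbarIterU i U' e : (Matrix (Fin 2) (Fin 2) ℂ)ˣ) : Matrix (Fin 2) (Fin 2) ℂ) = star (((dbarIterU i U e)⁻¹ : (Matrix (Fin 2) (Fin 2) ℂ)ˣ) : Matrix (Fin 2) (Fin 2) ℂ) := by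
  set ℓ : ℝ := (((P.d + 2) * P.L : ℕ) : ℝ) with hℓ
  have hℓ1 : (1 : ℝ) ≤ ℓ := by
    rw [hℓ]; exact_mod_cast Nat.one_le_iff_ne_zero.mpr (Nat.mul_ne_zero (by omega) (by have := P.hL.2; omega))
  have hL1 : (1 : ℝ) ≤ P.L := by exact_mod_cast P.L_pos
  intro i
  induction i with
  | zero =>
    intro _ S U U' s₀ _ _ _ hθ e hs ht
    rw [dbarIterU_zero, dbarIterU_zero]
    exact hθ e (by simpa only [iterBlockOf_zero] using hs) (by simpa only [iterBlockOf_zero] using ht)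
  | succ i ih =>
    intro hi S U U' s₀ hs₀ hbudget hU hθ c hcs hct
    have hbudget_i : 8 * 3800 * ℓ ^ 2 * (P.L : ℝ) ^ i * s₀ ≤ 1 := by
      refine le_trans ?_ hbudget
      have : (P.L : ℝ) ^ i ≤ (P.L : ℝ) ^ (i + 1) := pow_le_pow_right₀ hL1 (Nat.le_succ i)
      have h0 : 0 ≤ 8 * 3800 * ℓ ^ 2 * s₀ := by positivity
      nlinarith
    set S' : Set (Site P i) := {y | blockOf y ∈ S} with hS'
    have hU' : ∀ b : PBond P 0, iterBlockOf i b.src ∈ S' → iterBlockOf i b.tgt ∈ S' →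
        ‖((U b : (Matrix (Fin 2) (Fin 2) ℂ)ˣ) : Matrix (Fin 2) (Fin 2) ℂ) - 1‖ ≤ s₀ :=
      fun b hs ht => hU b (by rw [iterBlockOf_succ]; exact hs) (by rw [iterBlockOf_succ]; exact ht)
    have hθ' : ∀ b : PBond P 0, iterBlockOf i b.src ∈ S' → iterBlockOf i b.tgt ∈ S' →
        ((U' b : (Matrix (Fin 2) (Fin 2) ℂ)ˣ) : Matrix (Fin 2) (Fin 2) ℂ) = star (((U b)⁻¹ : (Matrix (Fin 2) (Fin 2) ℂ)ˣ) : Matrix (Fin 2) (Fin 2) ℂ) :=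
      fun b hs ht => hθ b (by rw [iterBlockOf_succ]; exact hs) (by rw [iterBlockOf_succ]; exact ht)
    have hF : ∀ e : PBond P i, e.src ∈ S' → e.tgt ∈ S' →
        ((dbarIterU i U' e : (Matrix (Fin 2) (Fin 2) ℂ)ˣ) : Matrix (Fin 2) (Fin 2) ℂ) = star (((dbarIterU i U e)⁻¹ : (Matrix (Fin 2) (Fin 2) ℂ)ˣ) : Matrix (Fin 2) (Fin 2) ℂ) :=
      ih (Nat.le_of_succ_le hi) S' U U' s₀ hs₀ hbudget_i hU' hθ'
    have hnear : ∀ e : PBond P i, e.src ∈ S' → e.tgt ∈ S' →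
        ‖((dbarIterU i U e : (Matrix (Fin 2) (Fin 2) ℂ)ˣ) : Matrix (Fin 2) (Fin 2) ℂ) - 1‖ ≤ 2 * ((P.L : ℝ) ^ i * s₀) :=
      fun e hs ht => norm_dbarIterU_sub_one_le_two_mul₀ (Nat.le_of_succ_le hi) S' U hs₀ hbudget_i hU' e hs ht
    rw [dbarIterU_succ, dbarIterU_succ]
    have hmem : ∀ b : PBond P i, (blockOf b.src = c.src ∨ blockOf b.src = c.tgt) → (blockOf b.tgt = c.src ∨ blockOf b.tgt = c.tgt) →
        b.src ∈ S' ∧ b.tgt ∈ S' := by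
      intro b hbs hbt
      constructor
      · show blockOf b.src ∈ S
        rcases hbs with h | h <;> rw [h]
        exacts [hcs, hct]
      · show blockOf b.tgt ∈ S
        rcases hbt with h | h <;> rw [h]
        exacts [hcs, hct]
    have h2x : 0 ≤ 2 * ((P.L : ℝ) ^ i * s₀) := by positivity
    have h12 : 12 * (((P.d + 2) * P.L : ℕ) : ℝ) * (2 * ((P.L : ℝ) ^ i * s₀)) ≤ 1 := by
      rw [← hℓ]
      have hx0 : 0 ≤ (P.L : ℝ) ^ i * s₀ := by positivity
      have hb' : 8 * 3800 * ℓ ^ 2 * ((P.L : ℝ) ^ i * s₀) ≤ 1 := by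
        have : 8 * 3800 * ℓ ^ 2 * ((P.L : ℝ) ^ i * s₀) = 8 * 3800 * ℓ ^ 2 * (P.L : ℝ) ^ i * s₀ := by ring
        rw [this]; exact hbudget_i
      nlinarith [mul_le_mul_of_nonneg_right hℓ1 (by positivity : (0 : ℝ) ≤ ℓ * ((P.L : ℝ) ^ i * s₀))]
    exact theta_dbarAvgU hi c h2x h12 (fun b hbs hbt => hnear b (hmem b hbs hbt).1 (hmem b hbs hbt).2)
      fun b hbs hbt => hF b (hmem b hbs hbt).1 (hmem b hbs hbt).2

/-- **`e^{iηA(b)⋆} = θ(e^{iηA(b)})`**: the charted configuration of the adjoint field is the `θ`-image of the charted configuration (`(e^{X})⁻¹ = e^{−X}`, `(e^{X})⋆ = e^{X⋆}`,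
`(iη)‾ = −iη`). [cite: Balaban1985Variational, (152) p.301, p.307] -/
theorem coe_expCfg_star (η : ℝ) (A : PBond P 0 → Matrix (Fin 2) (Fin 2) ℂ) (b : PBond P 0) :
    ((expCfg η (fun b => star (A b)) b : (Matrix (Fin 2) (Fin 2) ℂ)ˣ) : Matrix (Fin 2) (Fin 2) ℂ) =
      star ((((expCfg η A b)⁻¹ : (Matrix (Fin 2) (Fin 2) ℂ)ˣ)) : Matrix (Fin 2) (Fin 2) ℂ) := by
  letI : NormedAlgebra ℚ (Matrix (Fin 2) (Fin 2) ℂ) := NormedAlgebra.restrictScalars ℚ ℂ _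
  rw [Matrix.coe_units_inv, coe_expCfg, coe_expCfg, ← Matrix.exp_neg, star_exp, star_neg, star_smul, Complex.star_def, map_mul, Complex.conj_I,
    Complex.conj_ofReal, neg_mul, neg_smul, neg_neg]

/-! ## §3 The real structure of the double-bar chart -/

/-- **`Q♭(A⋆)(j,c) = (Q♭(A)(j,c))⋆` (index form, guarded)**: for every field `A₀` whose charted bond variables read by the index `(j,c)` are within `s₀` of `1`,
`30400·ℓ²·Lʲ·s₀ ≤ 1` (`U̿^{(j)}(e^{iηA⋆}) = θ(U̿^{(j)}(e^{iηA}))`, `log((X⋆)⁻¹) = −(log X)⋆` by ✓`mlog_star_inv` on `‖X − 1‖ ≤ 1∕3`, `(−i)‾ = i`).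
[cite: Balaban1985Variational, (20) p.281, p.307; Balaban1985Averaging, (23) p.21] -/
theorem chartLogFlat_star_of_reads (η : ℝ) (D : Domains P) (idx : BondIdx D) (A₀ : PBond P 0 → Matrix (Fin 2) (Fin 2) ℂ) {s₀ : ℝ} (hs₀ : 0 ≤ s₀)
    (hbudget : 8 * 3800 * (((P.d + 2) * P.L : ℕ) : ℝ) ^ 2 * (P.L : ℝ) ^ (idx.1.1 : ℕ) * s₀ ≤ 1)
    (hA : ∀ b : PBond P 0, (iterBlockOf (idx.1.1 : ℕ) b.src = idx.1.2.src ∨ iterBlockOf (idx.1.1 : ℕ) b.src = idx.1.2.tgt) →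
      (iterBlockOf (idx.1.1 : ℕ) b.tgt = idx.1.2.src ∨ iterBlockOf (idx.1.1 : ℕ) b.tgt = idx.1.2.tgt) →
      ‖((expCfg η A₀ b : (Matrix (Fin 2) (Fin 2) ℂ)ˣ) : Matrix (Fin 2) (Fin 2) ℂ) - 1‖ ≤ s₀) :
    chartLogFlat η D (fun b => star (A₀ b)) idx = star (chartLogFlat η D A₀ idx) := by
  have hj : (idx.1.1 : ℕ) ≤ P.m + P.K := (Nat.lt_succ_iff.mp idx.1.1.isLt).trans D.hk
  set S : Set (Site P (idx.1.1 : ℕ)) := {y | y = idx.1.2.src ∨ y = idx.1.2.tgt} with hS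
  have hA' : ∀ b : PBond P 0, iterBlockOf (idx.1.1 : ℕ) b.src ∈ S → iterBlockOf (idx.1.1 : ℕ) b.tgt ∈ S →
      ‖((expCfg η A₀ b : (Matrix (Fin 2) (Fin 2) ℂ)ˣ) : Matrix (Fin 2) (Fin 2) ℂ) - 1‖ ≤ s₀ := fun b hs ht => hA b hs ht
  have hθ := theta_dbarIterU_of_reads (idx.1.1 : ℕ) hj S (expCfg η A₀) (expCfg η fun b => star (A₀ b)) s₀ hs₀ hbudget hA'
    (fun b _ _ => coe_expCfg_star η A₀ b) idx.1.2 (Or.inl rfl) (Or.inr rfl)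
  have hnear := norm_dbarIterU_sub_one_le_two_mul₀ hj S (expCfg η A₀) hs₀ hbudget hA' idx.1.2 (Or.inl rfl) (Or.inr rfl)
  have hℓ1 : (1 : ℝ) ≤ (((P.d + 2) * P.L : ℕ) : ℝ) := by
    exact_mod_cast Nat.one_le_iff_ne_zero.mpr (Nat.mul_ne_zero (by omega) (by have := P.hL.2; omega))
  have hthird : ‖((dbarIterU (idx.1.1 : ℕ) (expCfg η A₀) idx.1.2 : (Matrix (Fin 2) (Fin 2) ℂ)ˣ) : Matrix (Fin 2) (Fin 2) ℂ) - 1‖ ≤ 1 / 3 := by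
    refine hnear.trans ?_
    have h0 : 0 ≤ (P.L : ℝ) ^ (idx.1.1 : ℕ) * s₀ := by positivity
    have h1 : 8 * 3800 * (((P.d + 2) * P.L : ℕ) : ℝ) ^ 2 * ((P.L : ℝ) ^ (idx.1.1 : ℕ) * s₀) ≤ 1 := by
      have : 8 * 3800 * (((P.d + 2) * P.L : ℕ) : ℝ) ^ 2 * ((P.L : ℝ) ^ (idx.1.1 : ℕ) * s₀) =
          8 * 3800 * (((P.d + 2) * P.L : ℕ) : ℝ) ^ 2 * (P.L : ℝ) ^ (idx.1.1 : ℕ) * s₀ := by ring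
      rw [this]; exact hbudget
    nlinarith [(one_le_pow₀ (M₀ := ℝ) hℓ1 : (1:ℝ) ≤ _ ^ 2)]
  rw [chartLogFlat_apply, chartLogFlat_apply, hθ, Matrix.coe_units_inv, Matrix.star_eq_conjTranspose, Matrix.conjTranspose_nonsing_inv,
    ← Matrix.star_eq_conjTranspose, mlog_star_inv hthird, star_smul, star_neg, Complex.star_def, Complex.conj_I, smul_neg, neg_smul, neg_neg, neg_neg]

/-- **`Q_lin(A⋆) = Q_lin(A)⋆`**: the linear part `η·Lʲ·Q_j` of `Q♭` at the origin (CERT-2 ✓`fderiv_chartLogFlat_zero_apply`) has real coefficients. [cite: Balaban1985Variational, (48) p.285] -/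
theorem fderiv_chartLogFlat_zero_star (η : ℝ) (D : Domains P) (Y : PBond P 0 → Matrix (Fin 2) (Fin 2) ℂ) (idx : BondIdx D) :
    fderiv ℂ (chartLogFlat η D : (PBond P 0 → Matrix (Fin 2) (Fin 2) ℂ) → BondIdx D → Matrix (Fin 2) (Fin 2) ℂ) 0 (fun b => star (Y b)) idx =
      star (fderiv ℂ (chartLogFlat η D : (PBond P 0 → Matrix (Fin 2) (Fin 2) ℂ) → BondIdx D → Matrix (Fin 2) (Fin 2) ℂ) 0 Y idx) := by
  -- the entrywise adjoint as an `ℝ`-linear map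
  let σ : Matrix (Fin 2) (Fin 2) ℂ →ₗ[ℝ] Matrix (Fin 2) (Fin 2) ℂ :=
    { toFun := fun M => star M
      map_add' := fun M N => star_add M N
      map_smul' := fun r M => by rw [star_smul, star_trivial, RingHom.id_apply] }
  have hσ : (fun b => star (Y b)) = fun b => σ (Y b) := rfl
  rw [fderiv_chartLogFlat_zero_apply, fderiv_chartLogFlat_zero_apply, hσ, ChartHInv.bondAvgIter_comp_apply σ, star_smul]
  congr 1
  rw [Complex.star_def, map_mul, map_pow, Complex.conj_ofReal, map_natCast]

/-- ★★ **`Q♭(A⋆) = Q♭(A)⋆` ON THE WEIGHTED BALL OF RECORD** (letters of ✓`norm_chartLogFlat_le_weightedBall₀`: level weights, collar, `60800·ℓ²·L·R ≤ 1`, `w₁‖A‖ < R`), at every index.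
[cite: Balaban1985Variational, (20) p.281, (44)-(47) p.285, p.307] -/
theorem chartLogFlat_star_weightedBall₀ (F : T3Family) (n K : ℕ) (D : Domains (F.P K)) (hDk : D.k = K - n)
    (hcollar : ∀ (i : ℕ) (e : PBond (F.P K) (i + 1)), D.LamBond (i + 1) e → ∀ z : Site (F.P K) i, (blockOf z = e.src ∨ blockOf z = e.tgt) → z ∈ D.Om i)
    {w : ℕ → PBond (F.P K) 0 → ℝ} (hw : IsLevWeight F n K D w)
    {R : ℝ} (hR : 16 * 3800 * ((((F.P K).d + 2) * (F.P K).L : ℕ) : ℝ) ^ 2 * (F.L : ℝ) * R ≤ 1)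
    {A : PBond (F.P K) 0 → Matrix (Fin 2) (Fin 2) ℂ} (hA : ∀ b, w 1 b * ‖A b‖ < R) (idx : BondIdx D) :
    chartLogFlat (((F.L : ℝ)⁻¹) ^ (K - n)) D (fun b => star (A b)) idx = star (chartLogFlat (((F.L : ℝ)⁻¹) ^ (K - n)) D A idx) := by
  have hL1 : (1 : ℝ) ≤ F.L := by exact_mod_cast (F.P K).L_pos
  have hL0 : (0 : ℝ) < F.L := by linarith
  have hℓ1 : (1 : ℝ) ≤ ((((F.P K).d + 2) * (F.P K).L : ℕ) : ℝ) := by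
    exact_mod_cast Nat.one_le_iff_ne_zero.mpr (Nat.mul_ne_zero (by omega) (by have := (F.P K).hL.2; omega))
  have hLj : 0 < (F.L : ℝ) ^ (idx.1.1 : ℕ) := by positivity
  have hR0 : 0 ≤ R := by
    have := hA (⟨fun _ => 0, idx.1.2.dir⟩ : PBond (F.P K) 0)
    have hw0 : 0 ≤ w 1 ⟨fun _ => 0, idx.1.2.dir⟩ * ‖A ⟨fun _ => 0, idx.1.2.dir⟩‖ := by
      rw [hw 1, pow_one]; exact mul_nonneg (by positivity) (norm_nonneg _)
    linarith
  have hLR : (F.L : ℝ) * R ≤ 1 := by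
    have h16 : (1 : ℝ) ≤ 16 * 3800 * ((((F.P K).d + 2) * (F.P K).L : ℕ) : ℝ) ^ 2 := by
      nlinarith [(one_le_pow₀ (M₀ := ℝ) hℓ1 : (1:ℝ) ≤ _ ^ 2)]
    nlinarith [mul_nonneg hL0.le hR0]
  set s₀ : ℝ := 2 * (F.L : ℝ) * R * ((F.L : ℝ) ^ (idx.1.1 : ℕ))⁻¹ with hs₀
  have hs₀0 : 0 ≤ s₀ := by positivity
  have hbudget : 8 * 3800 * ((((F.P K).d + 2) * (F.P K).L : ℕ) : ℝ) ^ 2 * (F.L : ℝ) ^ (idx.1.1 : ℕ) * s₀ ≤ 1 := by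
    have : 8 * 3800 * ((((F.P K).d + 2) * (F.P K).L : ℕ) : ℝ) ^ 2 * (F.L : ℝ) ^ (idx.1.1 : ℕ) * s₀ =
        16 * 3800 * ((((F.P K).d + 2) * (F.P K).L : ℕ) : ℝ) ^ 2 * (F.L : ℝ) * R := by
      rw [hs₀]; field_simp; ring
    rw [this]; exact hR
  have hA' : ∀ b : PBond (F.P K) 0, (iterBlockOf (idx.1.1 : ℕ) b.src = idx.1.2.src ∨ iterBlockOf (idx.1.1 : ℕ) b.src = idx.1.2.tgt) →
      (iterBlockOf (idx.1.1 : ℕ) b.tgt = idx.1.2.src ∨ iterBlockOf (idx.1.1 : ℕ) b.tgt = idx.1.2.tgt) →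
      ‖((expCfg (((F.L : ℝ)⁻¹) ^ (K - n)) A b : (Matrix (Fin 2) (Fin 2) ℂ)ˣ) : Matrix (Fin 2) (Fin 2) ℂ) - 1‖ ≤ s₀ :=
    fun b hb _ => norm_expCfg_sub_one_le_of_weightedBall_flat F n K D hDk hcollar hw hLR hA idx b hb
  have hLF : ((F.P K).L : ℝ) = F.L := by norm_cast
  exact chartLogFlat_star_of_reads (((F.L : ℝ)⁻¹) ^ (K - n)) D idx A hs₀0 (by rw [hLF]; exact hbudget) hA'

/-! ## §4 The `hΨsa` adapter: the unique small solution of (49) at a self-adjoint field is self-adjoint -/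

/-- a real-kernel extension commutes with the entrywise adjoint (the `Hs` spec (i) of ✓`exists_flatH_scaledExt` has real coefficients). [cite: Balaban1985Variational, (45) p.285] -/
theorem star_apply_of_realKernel {ι κ : Type*} [Fintype κ] (Hs : (κ → Matrix (Fin 2) (Fin 2) ℂ) → (ι → Matrix (Fin 2) (Fin 2) ℂ)) (k : ι → κ → ℝ)
    (hHs : ∀ X b, Hs X b = ∑ c, k b c • X c) (X : κ → Matrix (Fin 2) (Fin 2) ℂ) (b : ι) :
    star (Hs X b) = Hs (fun c => star (X c)) b := by
  rw [hHs, hHs, star_sum]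
  exact Finset.sum_congr rfl fun c _ => by rw [star_smul, star_trivial]

/-- **THE `hΨsa` ADAPTER (abstract (49) + uniqueness)**: if the remainder map `C` commutes with the entrywise adjoint at the dressed point `A′ − Hs Dv`, `Hs` commutes with it, `A′` is
bondwise self-adjoint and `Dv` is THE small solution of (49) `C(A′ − Hs Dv) = Dv` (uniqueness among data of size `≤ t`), then `Dv` is self-adjoint and so is the dressed field `A′ − Hs Dv`
(`Dv⋆` is a small solution too). [cite: Balaban1985Variational, (47)-(49) pp.285-286, p.307] -/
theorem isSelfAdjoint_dressed_of_unique {ι κ : Type*} (Hs : (κ → Matrix (Fin 2) (Fin 2) ℂ) → (ι → Matrix (Fin 2) (Fin 2) ℂ))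
    (hHs : ∀ X b, star (Hs X b) = Hs (fun c => star (X c)) b)
    (C : (ι → Matrix (Fin 2) (Fin 2) ℂ) → (κ → Matrix (Fin 2) (Fin 2) ℂ)) {A' : ι → Matrix (Fin 2) (Fin 2) ℂ} (hA' : ∀ b, IsSelfAdjoint (A' b))
    {Dv : κ → Matrix (Fin 2) (Fin 2) ℂ} {t : ℝ}
    (hC : C (fun b => star ((A' - Hs Dv) b)) = fun c => star (C (A' - Hs Dv) c))
    (h49 : C (A' - Hs Dv) = Dv) (hsize : ∀ c, ‖Dv c‖ ≤ t)
    (huniq : ∀ D' : κ → Matrix (Fin 2) (Fin 2) ℂ, (∀ c, ‖D' c‖ ≤ t) → C (A' - Hs D') = D' → D' = Dv) :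
    (∀ c, IsSelfAdjoint (Dv c)) ∧ ∀ b, IsSelfAdjoint ((A' - Hs Dv) b) := by
  -- the adjoint datum is a small solution too
  have hstar : ∀ D' : κ → Matrix (Fin 2) (Fin 2) ℂ, (fun b => star ((A' - Hs D') b)) = A' - Hs (fun c => star (D' c)) := fun D' =>
    funext fun b => by rw [Pi.sub_apply, Pi.sub_apply, star_sub, (hA' b).star_eq, hHs]
  have hsol : C (A' - Hs (fun c => star (Dv c))) = fun c => star (Dv c) := by
    rw [← hstar, hC, h49]
  have hfix : (fun c => star (Dv c)) = Dv := huniq _ (fun c => by rw [norm_star]; exact hsize c) hsol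
  have hDv : ∀ c, IsSelfAdjoint (Dv c) := fun c => congrFun hfix c
  refine ⟨hDv, fun b => ?_⟩
  show star ((A' - Hs Dv) b) = (A' - Hs Dv) b
  have h := congrFun (hstar Dv) b
  rw [hfix] at h
  exact h

/-- ★★ **`hΨsa` ON THE CHART OF RECORD**: for the remainder `C♭ = Q♭ − Q_lin` of the double-bar chart (FILE E's (49)∕(55)∕uniqueness shapes, ✓p616882) at a bondwise self-adjoint `A′`
whose dressed point lies in the weighted ball of record, the small solution `Dv` of (49) and the dressed field `A′ − Hs Dv` are self-adjoint.
[cite: Balaban1985Variational, (47)-(49) pp.285-286, (157)-(158) p.302] -/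
theorem isSelfAdjoint_dressed_chartOfRecord (F : T3Family) (n K : ℕ) (D : Domains (F.P K)) (hDk : D.k = K - n)
    (hcollar : ∀ (i : ℕ) (e : PBond (F.P K) (i + 1)), D.LamBond (i + 1) e → ∀ z : Site (F.P K) i, (blockOf z = e.src ∨ blockOf z = e.tgt) → z ∈ D.Om i)
    {w : ℕ → PBond (F.P K) 0 → ℝ} (hw : IsLevWeight F n K D w)
    {R : ℝ} (hR : 16 * 3800 * ((((F.P K).d + 2) * (F.P K).L : ℕ) : ℝ) ^ 2 * (F.L : ℝ) * R ≤ 1)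
    (Hs : (BondIdx D → Matrix (Fin 2) (Fin 2) ℂ) → (PBond (F.P K) 0 → Matrix (Fin 2) (Fin 2) ℂ))
    (hHs : ∀ X b, star (Hs X b) = Hs (fun c => star (X c)) b)
    {A' : PBond (F.P K) 0 → Matrix (Fin 2) (Fin 2) ℂ} (hA' : ∀ b, IsSelfAdjoint (A' b)) {Dv : BondIdx D → Matrix (Fin 2) (Fin 2) ℂ} {t : ℝ}
    (hball : ∀ b, w 1 b * ‖(A' - Hs Dv) b‖ < R)
    (h49 : chartLogFlat (((F.L : ℝ)⁻¹) ^ (K - n)) D (A' - Hs Dv) -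
        (fderiv ℂ (chartLogFlat (((F.L : ℝ)⁻¹) ^ (K - n)) D : (PBond (F.P K) 0 → Matrix (Fin 2) (Fin 2) ℂ) → BondIdx D → Matrix (Fin 2) (Fin 2) ℂ) 0) (A' - Hs Dv) = Dv)
    (hsize : ∀ c, ‖Dv c‖ ≤ t)
    (huniq : ∀ D' : BondIdx D → Matrix (Fin 2) (Fin 2) ℂ, (∀ c, ‖D' c‖ ≤ t) →
      chartLogFlat (((F.L : ℝ)⁻¹) ^ (K - n)) D (A' - Hs D') -
        (fderiv ℂ (chartLogFlat (((F.L : ℝ)⁻¹) ^ (K - n)) D : (PBond (F.P K) 0 → Matrix (Fin 2) (Fin 2) ℂ) → BondIdx D → Matrix (Fin 2) (Fin 2) ℂ) 0) (A' - Hs D') = D' →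
      D' = Dv) :
    (∀ c, IsSelfAdjoint (Dv c)) ∧ ∀ b, IsSelfAdjoint ((A' - Hs Dv) b) := by
  refine isSelfAdjoint_dressed_of_unique Hs hHs
    (fun Y => chartLogFlat (((F.L : ℝ)⁻¹) ^ (K - n)) D Y -
      (fderiv ℂ (chartLogFlat (((F.L : ℝ)⁻¹) ^ (K - n)) D : (PBond (F.P K) 0 → Matrix (Fin 2) (Fin 2) ℂ) → BondIdx D → Matrix (Fin 2) (Fin 2) ℂ) 0) Y)
    hA' (funext fun c => ?_) h49 hsize huniq
  rw [Pi.sub_apply, Pi.sub_apply, star_sub, chartLogFlat_star_weightedBall₀ F n K D hDk hcollar hw hR hball c,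
    fderiv_chartLogFlat_zero_star]

end Theta

end Summit.QuantumFields.YangMills.Theorems.Prop8ChartDoubleBar

end
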